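import Literature.Claims.NS.ClayVariants
import Literature.Analysis.FluidPDE.LerayHopf
import Literature.Analysis.FluidPDE.TorusABCFlow
import Literature.Analysis.FluidPDE.ClassicalSolutionTorusProofs
import Literature.Analysis.FunctionSpaces.TorusClassicalNSGluing
import Literature.Analysis.FluidPDE.TorusWeakStrongUniqueness
import Literature.Analysis.FluidPDE.NSHopfExistenceProofs
import Literature.Analysis.FluidPDE.NSLerayHopf
import Literature.Analysis.FluidPDE.TaoClassGlobal
import Literature.Analysis.FunctionSpaces.FlatTorusProofs
import Literature.Analysis.FunctionSpaces.TorusLinearisedNSEnergy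
import HarnessLib

/-!
# Claim skeleton: Glimm–Petrillo (2026), «Non-Smooth Solutions of the Navier–Stokes Equation and
# their Means» — finite-time loss of regularity on `𝕋³` by comparison of two decay rates

Cell `ns-claims` (D-0090 NS-CLAIMS SWEEP), claim C07, typist `ns-claims-typist-5` (refuter-3, ref-2,
salvage-p5). UNREFEREED/DISPUTED CLAIM under adjudication — NOTHING in this file asserts a step: every
`Step_k` is a `Prop` (the paper's k-th load-bearing assertion, typed concretely so that `¬ Step_k` or
its vacuity can be a kernel theorem in `Summits/…/Theorems/SoloRefuteGlimmPetrillo2026.lean`); the only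
`theorem`s are the kernel COMPOSITIONS of the paper's own implications, bookkeeping lemmas about the
typed vocabulary, and one non-vacuity lemma for the data class.

Version of record: J. Glimm, J. Petrillo, arXiv:2410.09261 **v10** (3 Jul 2026), math.AP
[GlimmPetrillo2026]; locators `l.N` = TeX line numbers of `nsmill.tex` of v10 (materialised with all ten
versions and the withdrawn companion arXiv:2505.13816 in `pub/ns-claims/sources/GlimmPetrillo2026/`,
`LOCATORS.md` by ns-claims-lit-3; no PDF pagination on this hub — theorem numbers are the paper's own).
VERSION DRIFT (F14, recorded not merged): v1 (Glimm–Lee–Petrillo 2024) «Initial conditions exist for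
which EVERY solution … has only a finite interval of regularity» (ℓ = 5 harmonic); v6 (2025) demotes the
statement to «Conjecture 5.1» and proves it «in the spherical harmonics subspace ℓ = 1»; v7–v10 re-promote
it as Theorem 5.1 below under the added words «entropy maximizing» and «turbulent energy mode»; the
companion 2505.13816 v1/v2 («solve the Millennium fluids problem in the positive») was WITHDRAWN (v3,
2025-07-23) and v10 l.222–226 no longer offers its §7 as Clay (B).

## Claimed statement (as printed)

Theorem 5.1, l.1204–1207: «An entropy maximizing solution of the Navier-Stokes equation with turbulent
energy mode initial conditions has only a finite interval of regularity. It is not globally smooth in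
time.» Setting: «a finite periodic cube 𝕋³» (l.83, l.131), `f = 0` (l.215, l.416), real single
incompressible fluid, `ν > 0` (l.193), zero spatial average (l.808, l.814–815), weak solutions of
Leray–Hopf class in the sense of Robinson–Rodrigo–Sadowski Def. 3.3 (l.492–515; §1.2 l.136–138: «The LH
assumption has a unique role in this paper, which is to guarantee existence of weak solutions whose
initial conditions have been specified»; l.1196–1197: «The LH weak solution defined by this data lies in
𝒱*. We prove blowup for this weak solution»). Offered as Clay: §1.4 l.209–220 «If it can be shown that
these conditions are not satisfied for some weak solution of the Navier-Stokes equation, the prize problem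
is solved in the negative. We solve the prize problem in the negative. We choose f = 0. … This paper is
offered as a solution of the Millennium Fluids problem.»

Printed proof of Theorem 5.1 (l.1209–1243, quoted at the steps): «Assume the solution is within an
interval of regularity starting from its initial conditions. Initial conditions are chosen with the E
mode strictly non-zero, non-SRI. … These initial conditions are smooth since they lie within the span of
a finite number of eigenvalues of the Stokes operator. … ν_t(s) ∈ 𝒲 decreases as a function of s at least
at the rate O(e^{−4νt/3}) and is always greater than the solution u decay curve. The viscous decay rate
for u is O(e^{−νt/2}). For a finite value of s, ν_t(s) is smaller than the viscous decaying u, with the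
decay rate O(e^{−νt/2}), since 4/3 > 1/2. Thus at this time, ν_t falls below the smooth solution viscous
decay allowed minimum value for u. An endpoint to the epoch of regularity has been reached. This time is
T* < ∞. T* is the time of blowup.» The same comparison is §1.5 «Three Contradictory Facts» l.254–298 and
Fig. 1 l.303–317.

## Typing decisions (read before refuting; F17 = undisplayed objects, TYPING-HYGIENE 6/7/11)

* CARRIER. The paper's `𝕋³` is typed as the tree's unit flat torus `UnitAddTorus (Fin 3)` = Fefferman's
  `ℝ³/ℤ³` (Clay (B)/(D); Δ1 EQUIVALENT for any side `L` by the parabolic rescaling, Tao 2013 Rem. 1.2).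
  The printed rates `e^{−νt/2}`, `e^{−4νt/3}` carry no length scale (l.587 leaves the side `L` free); for a
  cube of side `L` read `ν ↦ νL²` in the three rate constants below — the composition uses only
  `4/3 > 1/2`.
* SOLUTIONS. Leray–Hopf weak solutions = `FluidPDE.Torus.IsGlobalLerayHopf ν 0 u₀ u` (built on
  Robinson–Rodrigo–Sadowski Def. 3.3/4.9, the paper's own reference l.492–515); «interval of regularity
  [0,T) starting from the initial conditions» (l.1210–1211, l.1079–1081) = `IsRegularityInterval`: on
  `(0,T)` the weak solution coincides slice-wise a.e. with a classical solution
  `FunctionSpaces.Torus.IsClassicalNSSolutionOn (Ico 0 T) ν 0 v p`, `v 0 = u₀` (a.e. because a Leray–Hopf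
  field is an `L²`-valued object; `t = 0` excluded because the Leray–Hopf slice at `0` is not pinned by
  the tree structure); «globally smooth in time» = `IsGloballyRegular` (the same on `[0,∞)`).
* DATA. «turbulent energy mode initial conditions … within the span of a finite number of eigenvalues of
  the Stokes operator» (l.1205, l.1213–1216), zero average (l.814–815): `IsFiniteModeDatum u₀` (a real
  vector trigonometric polynomial `realTrigPoly S c`, divergence free, zero mean) with `u₀ ≠ 0` («E mode
  strictly non-zero», l.1213; abstract l.81–82 «nonzero energy related turbulent fluctuations»).
* THE TWO UNDEFINED QUALIFIERS are carried as an explicit parameter `N : Notions` (F17): «entropy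
  (production) maximizing solution» (§3 l.860–900: «The entropy is defined as the log volume of a surface
  of constant energy plus the log volume of a surface of constant enstrophy within a surface of constant
  energy. The maximum production of entropy is a fundamental law of physics»; Thm 3.1(a) l.975–981) and
  «turbulent / non-SRI» data (Def. 5.1 l.1182–1188: «Initial data u₀ is called laminar (non-turbulent) if
  it is SRI. Such basis functions are proportional to a mean value. The data is otherwise defined to be
  turbulent», with l.819–820 «A summation over repeated tensor indices is denoted SRI») have NO
  mathematical definition in print that a vector field or a weak solution could be checked against. They
  enter ONLY the hypotheses of the headline (`ClaimedTheorem N`, `ClaimedTheoremClassical N`) and the two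
  existence steps `Step_1 N`, `Step_2 N`; the three load-bearing analytic steps `Step_3`–`Step_5` are
  N-FREE, because the paper prints them for every (zero-average) solution: the rate rule l.248–252 is
  stated for «The Navier-Stokes solutions u ∈ 𝒲^p», Theorem 3.1 for the selected solution «with the same
  initial conditions» as «any weak solution» (l.979–981) — any datum — and the proof of Theorem 5.1 applies
  (b), (c) and the rate rule to «the solution within an interval of regularity», i.e. to the classical
  solution on `[0,T)`. `Notions.natural` is the only checkable reading the text offers (no selection —
  every Leray–Hopf solution from the datum, which is what l.1196–1197 says; turbulent := non-zero, which is
  Def. 5.1 under the zero-average normalisation: «proportional to a mean value» = 0).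
* THE FUNCTIONALS (natural reconstruction of eq. (nu-NL) l.686–694, the form the proof of Thm 5.1
  consumes as «ν_t(s)», l.1228, l.1235): `nuNL v s = ∫ ⟪(v·∇)v, v⟫` (= `⟨Σ_j u_j ∂_j u_i⟩` paired with `u`
  as in the proof of Lemma 3.1, eq. (weak-en-1) l.943–946), `nuTemp S v s = ∫ ⟪v, −∂ₜv⟫` (= «ν_{t,Temp} =
  ⟨u_i, −∂_t u_i⟩», l.690, `⟨·,·⟩` the `L²(𝕋³)` inner product l.330–335), `nuT = nuNL + nuTemp` (l.691).
  «The solution u decay curve» / «the norm of u in 𝒲» (l.989–991, l.1017–1018, l.1230, l.1236) =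
  `solNorm v s = ‖v(s)‖_{L²(𝕋³)}` (reading R1, `Step_3`/`Step_5`); the competing reading R2 — «the
  solution viscous decay» (Fig. 1 l.305–306, §2.8 l.719–720) = the viscous dissipation rate
  `dissRate ν v s = ν‖∇v(s)‖²` — is typed as `Step_3alt`/`Step_5alt` with its own composition (for a
  classical solution the energy identity makes `ν_t = ν‖∇v‖²`, so R2 renders the domination step an
  identity and isolates the floor). Not typed: the «integrands» `ν_t^int` (l.699–706; reading (α)
  `u_i − ∂_t u_i` as printed vs (β) `u_i·(−∂_t u_i)` as the integrand of l.690) — Thm 5.1 consumes `ν_t`,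
  not `ν_t^int`; the referee's charitable re-typings R#B/R#C (claims/GlimmPetrillo2026/RETYPE.md) cover
  (α)/(β). The printed rate of Thm 3.1(b)/Thm 5.1 is `e^{−4νt/3}`; §1.5 l.274 prints `e^{−3νt/4}` and
  Fig. 1 `t^{−4/3}` vs `t^{−1/2}` — any ceiling rate `> 1/2` composes identically.
* QUANTIFIER ORDER (A1/F11): the decay constants `c`, `C` of Steps 3–4 depend on `(ν, u₀)` only («a bound
  independent of time t > 0», Fig. 1 l.307; the curves of Fig. 1 are fixed by the data) and are uniform
  over all regularity intervals — this is what makes «only a FINITE interval of regularity» (one `T*` for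
  the datum) follow; a per-interval `∃ c` would not compose.

## Clay delta (reference `ClayVariants.lean`; lead ruling 15:36Z: NEG, judged against (D))

Nearest: (D). Δ1 domain 𝕋³ = ℝ³/ℤ³ (EQUIVALENT) · Δ2 equations: NS, `ν > 0` (=) · Δ3 force `f ≡ 0`
(admissible witness force: `clayPeriodicErrata_force_zero`) · Δ4 data: C^∞ periodic divergence-free
(finite Stokes modes: INSIDE the Clay class) · Δ5 solution notion: the headline is about ONE selected
Leray–Hopf weak solution losing regularity — it reaches «no Clay-sense smooth solution» only through the
paper's §1.4 sentence l.210–212 («not satisfied for some weak solution ⇒ negative»), typed as `Step_6`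
(TRUE classically for Leray–Hopf solutions from smooth data: weak–strong uniqueness on 𝕋³, Robinson–
Rodrigo–Sadowski Thm 6.10, tree `Literature.Analysis.FluidPDE.Torus.IsLerayHopfOn.ae_eq_of_isClassicalNSSolutionOn`
(p461824) with classical ⇒ Leray–Hopf `…Torus.isGlobalLerayHopf_of_isClassicalNSSolutionOn` and the
torus/ℝ³ descent `IsClassicalNSSolutionOn.to_torus_holds`) · Δ6 conclusion: loss of smoothness of the
solution from a smooth datum (= ¬(B) form) · Δ7 every `ν > 0` (=) · Δ8 negation: errata-(D) (u AND p
periodic excluded) is what `Step_6` reaches — `clay_of_claimed : … → clayPeriodicErrata.Breakdown` is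
PROVED from Steps 1–6; printed (D) (pressure unconstrained) needs in addition Tao's pressure
normalisation (Prop. 1.7-type, not landed; `clayPeriodic_breakdown_imp_errata` is the converse
direction). So: NOT a «wrong problem» candidate — if Steps 1–6 held, errata-(D) would follow
(escalation-grade; lead informed at TYPED).

## Steps (ordered index, TYPING-HYGIENE 11: dependency order, ties by print order)

* Step 1 = `Step_1 N` — DATA: turbulent energy-mode data exist among the non-zero finite-Stokes-mode
  fields (Def. 5.1 l.1182–1188; Thm 5.1 proof l.1213–1216, l.1225–1226; §1.1 l.119–120). Consumed by the
  Clay link only. Flag: true for `Notions.natural` (`exists_finiteModeDatum_ne_zero`); undefined in print.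
* Step 2 = `Step_2 N` — Thm 3.1(a) l.975–981 with l.1196–1197 and §1.2 l.136–138: for every admissible
  datum an entropy-maximizing global Leray–Hopf solution EXISTS. Consumed by the Clay link only. Flag: its
  Leray–Hopf half is classical (Leray–Hopf existence on 𝕋³); its selection half is undefined in print.
* Step 3 = `Step_3` (R1) | `Step_3alt` (R2) — FLOOR, the rate rule §1.5 l.248–252 («The Navier-Stokes
  solutions u ∈ 𝒲^p decay with the rate O(e^{−νt/p}) or faster. … with an important exception: the SRI
  O(e^{−νt/2}) decay rate is exact. It is not an upper bound.»), Fact 1 l.263–268, consumed at l.1232–1240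
  («the smooth solution viscous decay allowed minimum value for u») and Fig. 1 l.305–308. Flag: SUSPICIOUS
  under both readings (every Stokes eigenmode `e^{−4π²|k|²νt}·w` on ℝ³/ℤ³ is an exact solution whose norm
  and dissipation rate decay faster than `e^{−νt/2}`).
* Step 4 = `Step_4` — CEILING, Thm 3.1(b) l.983–984 («with decay O(e^{−4νt/3})»), Fact 2 l.270–277,
  consumed at l.1228–1229. Flag: plausible on ℝ³/ℤ³ for global solutions (Poincaré), unverifiable on a
  blow-up interval.
* Step 5 = `Step_5` (R1) | `Step_5alt` (R2) — DOMINATION, Thm 3.1(c) l.986–991 («ν_t^int is non-negative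
  and at least equal to the decay of the solution u. The norm of … u in 𝒲 … is smaller than the norm of
  ν_t^int in 𝒲»), Fact 3 l.279–285, §2.8 l.717–721, consumed at l.1230. Flag: SUSPICIOUS under R1
  (quadratic vs linear in the amplitude); an identity under R2 for classical solutions (energy balance).
  Its printed proof l.1020–1023 is the inference `Thm31cProofInference` (support decl, F15).
* Step 6 = `Step_6` — PRIZE LINK, §1.4 l.209–217: a Leray–Hopf weak solution from a smooth periodic datum
  that is not globally regular excludes a Clay-sense smooth solution (errata reading). Consumed by the Clay
  link only. Flag: classical (weak–strong uniqueness, decls above).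
Support decls NOT consumed by any composition: `Lemma31` (l.935–959, energy equality; cited l.268 as the
proof of the floor, which it does not imply), `Theorem41` (l.1163–1175, isolated singular times),
`RateRuleD1` (l.248–249, abstract form, F15), `Thm31cProofInference` (l.1020–1023, F15), `Theorem71`
(§7 l.1445–1451, over an undefined mean operator; OTHER direction, withdrawn as (B) in v10 l.222–226).

## COMPOSITION — proved

* `claim_of_steps N : Step_1 N → Step_2 N → Step_3 → Step_4 → Step_5 → Step_6 → ClaimedTheorem N` —
  PROVED for every `N`; it CONSUMES Steps 3, 4, 5 only, through the (valid) real-number lemma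
  `le_horizon_of_decay_sandwich` («two decay laws with 4/3 > 1/2 cross at T* = (6/(5ν)) log(C/c)», eq.
  (compare) l.294–298) and the bookkeeping conclusion `FiniteHorizon`: the paper's logic composes; the
  weight of the headline sits on Steps 3–5. `claim_of_steps_alt` is the same under reading R2.
* `claimClassical_of_steps N : Step_3 → Step_4 → Step_5 → ClaimedTheoremClassical N` — PROVED (the
  classical-level reading asked for by refuter-3: no global classical solution from any such datum).
* `clay_of_claimed N : Step_1 N → Step_2 N → Step_3 → Step_4 → Step_5 → Step_6 →
  ClayVariants.clayPeriodicErrata.Breakdown` — PROVED (consumes all six; `clay_of_claimed_alt` under R2).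

WHAT THIS IS NOT: not a claim about NS regularity or blow-up; not a claim about any author beyond the
typed locator.
-/

open MeasureTheory Set Filter
open scoped ContDiff RealInnerProductSpace Topology

namespace Literature.Claims.NS.GlimmPetrillo2026

open Literature.Analysis
open Literature.Analysis.FunctionSpaces.Torus (realTrigPoly isSmooth_realTrigPoly)

noncomputable section

/-! ## Vocabulary (definitions with bodies; nothing asserted) -/

/-- The two notions of the paper that have NO mathematical definition in print, carried as explicit
parameters (F17): `IsEntropyMax ν u₀ u` = «`u` is an entropy (production) maximizing solution of the
Navier–Stokes equation with viscosity `ν` and initial data `u₀`» (§3 l.860–900, Theorem 3.1 (a)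
l.975–981); `IsTurbulent u₀` = «the initial data is turbulent (non-SRI, E mode non-zero)» (Definition 5.1
l.1182–1188, l.1213–1214). Every statement of this file that mentions them takes `N : Notions` as an
argument; no property of `N` is postulated anywhere. (GlimmPetrillo2026: §3 l.860–900, Thm 3.1(a) l.975–981, Def. 5.1 l.1182–1188) [claim: GlimmPetrillo2026, status: disputed] -/
structure Notions where
  /-- «entropy (production) maximizing solution» for viscosity `ν` and datum `u₀` — undefined in print. -/
  IsEntropyMax : ℝ → (UnitAddTorus (Fin 3) → EuclideanSpace ℝ (Fin 3)) →
    (ℝ → UnitAddTorus (Fin 3) → EuclideanSpace ℝ (Fin 3)) → Prop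
  /-- «turbulent (non-laminar, non-SRI) initial data» — undefined in print beyond Def. 5.1. -/
  IsTurbulent : (UnitAddTorus (Fin 3) → EuclideanSpace ℝ (Fin 3)) → Prop

/-- The only checkable reading the text offers (natural reconstruction, recorded as such): NO selection
— every Leray–Hopf weak solution from the datum is «the LH weak solution defined by this data» for which
blow-up is proved (l.1196–1197; referee's R#0) — and «turbulent» := non-zero, which is Definition 5.1
(«laminar … proportional to a mean value; otherwise turbulent», l.1183–1187) under the
zero-average normalisation l.814–815, and the abstract's «nonzero … turbulent fluctuations» (l.81–82).
(GlimmPetrillo2026: Def. 5.1 l.1182–1188, l.814–815, l.1196–1197) [claim: GlimmPetrillo2026, status: disputed] -/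
def Notions.natural : Notions where
  IsEntropyMax := fun _ _ _ => True
  IsTurbulent := fun u₀ => u₀ ≠ 0

/-- The class of initial data used throughout the paper: smooth, divergence-free, of zero spatial
average (the normalisation fixed at l.814–815 for everything after §2.10: «… the Navier-Stokes
solution [has] a zero spatial average»; incompressibility l.355–356; square brackets inside quotations
are the typist's). (GlimmPetrillo2026: §2.10 l.800–815) [claim: GlimmPetrillo2026, status: disputed] -/
def IsAdmissibleDatum (u₀ : UnitAddTorus (Fin 3) → EuclideanSpace ℝ (Fin 3)) : Prop :=
  FunctionSpaces.Torus.IsSmooth u₀ ∧ FunctionSpaces.Torus.IsDivFree u₀ ∧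
    FunctionSpaces.Torus.HasZeroMean u₀

/-- The data class of Theorem 5.1 as the proof states it (l.1213–1216: «within the span of a finite number
of eigenvalues of the Stokes operator», hence smooth; divergence free; zero average l.814–815): a real
vector trigonometric polynomial (finitely many Fourier = Stokes modes on `ℝ³/ℤ³`), divergence free, of
zero mean. (GlimmPetrillo2026: Thm 5.1 proof l.1213–1216) [claim: GlimmPetrillo2026, status: disputed] -/
def IsFiniteModeDatum (u₀ : UnitAddTorus (Fin 3) → EuclideanSpace ℝ (Fin 3)) : Prop :=
  (∃ (S : Finset (Fin 3 → ℤ)) (c : (Fin 3 → ℤ) → EuclideanSpace ℂ (Fin 3)), u₀ = realTrigPoly S c) ∧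
    FunctionSpaces.Torus.IsDivFree u₀ ∧ FunctionSpaces.Torus.HasZeroMean u₀

/-- Finite-mode data are admissible (trigonometric polynomials are smooth, `isSmooth_realTrigPoly`).
(GlimmPetrillo2026: Thm 5.1 proof l.1215–1216) [claim: GlimmPetrillo2026, status: disputed] -/
theorem IsFiniteModeDatum.isAdmissibleDatum {u₀ : UnitAddTorus (Fin 3) → EuclideanSpace ℝ (Fin 3)}
    (h : IsFiniteModeDatum u₀) : IsAdmissibleDatum u₀ := by
  obtain ⟨⟨S, c, rfl⟩, hdiv, hmean⟩ := h
  exact ⟨isSmooth_realTrigPoly S c, hdiv, hmean⟩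

/-- Non-vacuity of the data class (Prop. 2.10.x, «The achievability of the initial data … follows from
known results», l.119–120): the ABC flow is a non-zero divergence-free zero-mean single-shell
trigonometric polynomial on `ℝ³/ℤ³` (tree: `Torus.abcFlow`). (GlimmPetrillo2026: §1.1 l.119–120 and Thm 5.1 proof l.1213–1216) [claim: GlimmPetrillo2026, status: disputed] -/
theorem exists_finiteModeDatum_ne_zero :
    ∃ u₀ : UnitAddTorus (Fin 3) → EuclideanSpace ℝ (Fin 3), IsFiniteModeDatum u₀ ∧ u₀ ≠ 0 := by
  refine ⟨FluidPDE.Torus.abcFlow 1 1 1, ⟨⟨_, _, FluidPDE.Torus.abcFlow_eq_realTrigPoly 1 1 1⟩,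
    FluidPDE.Torus.isDivFree_abcFlow 1 1 1, FluidPDE.Torus.hasZeroMean_abcFlow 1 1 1⟩, fun h => ?_⟩
  have hint := FluidPDE.Torus.integral_norm_sq_abcFlow 1 1 1
  rw [h] at hint
  norm_num at hint

/-- `[0,T)` is an INTERVAL OF REGULARITY of the weak solution `u` from the datum `u₀` («[Suppose] the
solution is within an interval of regularity starting from its initial conditions», l.1210–1211; «the
solution is strong (in 𝒱) except for … singular times», l.1079–1081): there is a classical solution
`(v, p)` of the unforced Navier–Stokes equations on `𝕋³ × [0,T)` with `v(0) = u₀` with which `u`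
coincides a.e. on every time slice `t ∈ (0,T)`. (GlimmPetrillo2026: Thm 5.1 proof l.1210–1211 and l.1079–1081) [claim: GlimmPetrillo2026, status: disputed] -/
def IsRegularityInterval (ν : ℝ) (u₀ : UnitAddTorus (Fin 3) → EuclideanSpace ℝ (Fin 3))
    (u : ℝ → UnitAddTorus (Fin 3) → EuclideanSpace ℝ (Fin 3)) (T : ℝ) : Prop :=
  ∃ (v : ℝ → UnitAddTorus (Fin 3) → EuclideanSpace ℝ (Fin 3)) (p : ℝ → UnitAddTorus (Fin 3) → ℝ),
    FunctionSpaces.Torus.IsClassicalNSSolutionOn (Ico 0 T) ν 0 v p ∧ v 0 = u₀ ∧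
      ∀ t ∈ Ioo 0 T, u t =ᵐ[volume] v t

/-- «has only a finite interval of regularity» (l.1206, l.1241–1242 «An endpoint to the epoch of
regularity has been reached. This time is T* < ∞»): every interval of regularity `[0,T)` of `u` from
`u₀` has `T ≤ T*` for one finite `T*`. (GlimmPetrillo2026: Thm 5.1 l.1204–1207 and l.1241–1243) [claim: GlimmPetrillo2026, status: disputed] -/
def HasFiniteRegularity (ν : ℝ) (u₀ : UnitAddTorus (Fin 3) → EuclideanSpace ℝ (Fin 3))
    (u : ℝ → UnitAddTorus (Fin 3) → EuclideanSpace ℝ (Fin 3)) : Prop :=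
  ∃ Tstar : ℝ, ∀ T : ℝ, IsRegularityInterval ν u₀ u T → T ≤ Tstar

/-- «globally smooth in time» (l.1206–1207) for a weak solution `u` from `u₀`: `u` coincides a.e. on
every slice `t > 0` with a GLOBAL classical solution `(v, p)` on `𝕋³ × [0,∞)` from `u₀`.
(GlimmPetrillo2026: Thm 5.1 l.1206–1207) [claim: GlimmPetrillo2026, status: disputed] -/
def IsGloballyRegular (ν : ℝ) (u₀ : UnitAddTorus (Fin 3) → EuclideanSpace ℝ (Fin 3))
    (u : ℝ → UnitAddTorus (Fin 3) → EuclideanSpace ℝ (Fin 3)) : Prop :=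
  ∃ (v : ℝ → UnitAddTorus (Fin 3) → EuclideanSpace ℝ (Fin 3)) (p : ℝ → UnitAddTorus (Fin 3) → ℝ),
    FunctionSpaces.Torus.IsClassicalNSSolutionOn (Ici 0) ν 0 v p ∧ v 0 = u₀ ∧
      ∀ t : ℝ, 0 < t → u t =ᵐ[volume] v t

/-- «The solution u decay curve» / «the norm of u» at time `s` (l.989–991, l.1017–1018, l.1230, l.1236):
the `L²(𝕋³)` norm `‖v(s)‖₂ = (∫ ‖v(s,x)‖² dx)^{1/2}` of the time slice. Meaningful for the classical
slices it is applied to. (GlimmPetrillo2026: Thm 3.1(c) l.989–991 and Thm 5.1 proof l.1230–1240) [claim: GlimmPetrillo2026, status: disputed] -/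
def solNorm (v : ℝ → UnitAddTorus (Fin 3) → EuclideanSpace ℝ (Fin 3)) (s : ℝ) : ℝ :=
  Real.sqrt (∫ x, ‖v s x‖ ^ 2)

/-- `ν_{t,NL}(s) = ⟨Σ_j u_j ∂_j u_i⟩` at time `s` (eq. (nu-NL) l.689), in the paired form in which it
enters the paper's conservation law, eq. (weak-en-1) l.943–946: `∫_{𝕋³} ⟪((v·∇)v)(s,x), v(s,x)⟫ dx`.
(GlimmPetrillo2026: eq. (nu-NL) l.686–694 and eq. (weak-en-1) l.943–946) [claim: GlimmPetrillo2026, status: disputed] -/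
def nuNL (v : ℝ → UnitAddTorus (Fin 3) → EuclideanSpace ℝ (Fin 3)) (s : ℝ) : ℝ :=
  ∫ x, ⟪FunctionSpaces.Torus.convect (v s) (v s) x, v s x⟫

/-- `ν_{t,Temp}(s) = ⟨u_i, −∂_t u_i⟩` at time `s` (eq. (nu-NL) l.690; `⟨·,·⟩` the `L²(𝕋³)` inner product,
l.330–335): `∫_{𝕋³} ⟪v(s,x), −∂ₜv(s,x)⟫ dx`, the time derivative taken within the time set `S` of the
classical solution (one-sided at `0`, the tree convention). (GlimmPetrillo2026: eq. (nu-NL) l.686–694) [claim: GlimmPetrillo2026, status: disputed] -/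
def nuTemp (S : Set ℝ) (v : ℝ → UnitAddTorus (Fin 3) → EuclideanSpace ℝ (Fin 3)) (s : ℝ) : ℝ :=
  ∫ x, ⟪v s x, -FunctionSpaces.Torus.timeDerivWithin S v s x⟫

/-- The turbulent dissipation `ν_t(s) = ν_{t,NL}(s) + ν_{t,Temp}(s)` (eq. (nu-NL) l.691) — the quantity the
proof of Theorem 5.1 compares with the decay curve of `u` (l.1228, l.1235). (GlimmPetrillo2026: eq. (nu-NL) l.686–694 and Thm 5.1 proof l.1228–1240) [claim: GlimmPetrillo2026, status: disputed] -/
def nuT (S : Set ℝ) (v : ℝ → UnitAddTorus (Fin 3) → EuclideanSpace ℝ (Fin 3)) (s : ℝ) : ℝ :=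
  nuNL v s + nuTemp S v s

/-- Second reading (R2) of «the decay of the solution u» / «the solution viscous decay» (Fig. 1 l.305–306
«one for the solution viscous decay O(t^{−1/2})»; §2.8 l.719–720 «the yellow viscous decay curve»; the
viscous term `ν‖∇u‖²` of `ν_Tot`, eq. (nu-NL) l.692): the VISCOUS DISSIPATION RATE `ν‖∇v(s)‖²_{L²(𝕋³)}` of
the time slice (tree functional `Torus.gradNormSq`). Under R2 the floor and the domination steps are
`Step_3alt` / `Step_5alt`. (GlimmPetrillo2026: eq. (nu-NL) l.692, §2.8 l.717–721, Fig. 1 l.305–311) [claim: GlimmPetrillo2026, status: disputed] -/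
def dissRate (ν : ℝ) (v : ℝ → UnitAddTorus (Fin 3) → EuclideanSpace ℝ (Fin 3)) (s : ℝ) : ℝ :=
  ν * FunctionSpaces.Torus.gradNormSq (v s)

/-! ## The claimed statement -/

/-- **Theorem 5.1 as printed (Leray–Hopf level)**, l.1204–1207: for every viscosity `ν > 0`, every
non-zero finite-Stokes-mode divergence-free zero-mean datum that is «turbulent» in the sense `N`, and
every global Leray–Hopf weak solution `u` from it that is «entropy maximizing» in the sense `N`
(l.1196–1197: «The LH weak solution defined by this data … We prove blowup for this weak solution»), `u`
has only a finite interval of regularity and is not globally smooth in time.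
(GlimmPetrillo2026: Thm 5.1 l.1204–1207) [claim: GlimmPetrillo2026, status: disputed] -/
def ClaimedTheorem (N : Notions) : Prop :=
  ∀ ν : ℝ, 0 < ν →
    ∀ u₀ : UnitAddTorus (Fin 3) → EuclideanSpace ℝ (Fin 3), IsFiniteModeDatum u₀ → u₀ ≠ 0 →
      N.IsTurbulent u₀ →
      ∀ u : ℝ → UnitAddTorus (Fin 3) → EuclideanSpace ℝ (Fin 3),
        FluidPDE.Torus.IsGlobalLerayHopf ν 0 u₀ u → N.IsEntropyMax ν u₀ u →
          HasFiniteRegularity ν u₀ u ∧ ¬ IsGloballyRegular ν u₀ u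

/-- **Theorem 5.1, classical-level reading** (the form refuter-3 asked for; l.1204–1207 read with
l.1210–1216 «[Suppose] the solution is within an interval of regularity … These initial conditions are
smooth»): for every `ν > 0` and every non-zero turbulent finite-mode datum, the classical solutions from
it live on intervals `[0,T)` with `T ≤ T* < ∞`, and there is NO global classical solution from it.
(GlimmPetrillo2026: Thm 5.1 l.1204–1216) [claim: GlimmPetrillo2026, status: disputed] -/
def ClaimedTheoremClassical (N : Notions) : Prop :=
  ∀ ν : ℝ, 0 < ν →
    ∀ u₀ : UnitAddTorus (Fin 3) → EuclideanSpace ℝ (Fin 3), IsFiniteModeDatum u₀ → u₀ ≠ 0 →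
      N.IsTurbulent u₀ →
      (∃ Tstar : ℝ, ∀ (T : ℝ) (v : ℝ → UnitAddTorus (Fin 3) → EuclideanSpace ℝ (Fin 3))
          (p : ℝ → UnitAddTorus (Fin 3) → ℝ),
          FunctionSpaces.Torus.IsClassicalNSSolutionOn (Ico 0 T) ν 0 v p → v 0 = u₀ → T ≤ Tstar) ∧
      ¬ ∃ (v : ℝ → UnitAddTorus (Fin 3) → EuclideanSpace ℝ (Fin 3)) (p : ℝ → UnitAddTorus (Fin 3) → ℝ),
          FunctionSpaces.Torus.IsClassicalNSSolutionOn (Ici 0) ν 0 v p ∧ v 0 = u₀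

/-! ## The steps -/

/-- **Step 1 — DATA (Definition 5.1 l.1182–1188; proof of Thm 5.1 l.1213–1216 «Initial conditions are
chosen with the E mode strictly non-zero, non-SRI. In other words, they are chosen with non-zero NSRI
energy modes. These initial conditions are smooth since they lie within the span of a finite number of
eigenvalues of the Stokes operator», l.1225–1226; §1.1 l.119–120).** Turbulent energy-mode initial data
exist among the non-zero divergence-free zero-mean finite-Stokes-mode fields. Depends on the undefined
`N.IsTurbulent`; for `Notions.natural` it is `exists_finiteModeDatum_ne_zero`. Consumed by the Clay link
only. (GlimmPetrillo2026: Def. 5.1 l.1182–1188 and Thm 5.1 proof l.1213–1216) [claim: GlimmPetrillo2026, status: disputed] -/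
def Step_1 (N : Notions) : Prop :=
  ∃ u₀ : UnitAddTorus (Fin 3) → EuclideanSpace ℝ (Fin 3), IsFiniteModeDatum u₀ ∧ u₀ ≠ 0 ∧ N.IsTurbulent u₀

/-- **Step 2 — Theorem 3.1 (a), l.975–981: «An entropy principle solution of the Navier-Stokes equation
exists in 𝒲 which maximizes the entropy production of u and of ν_t^int relative to the entropy production
of u and of ν_t^int defined by any weak solution of the Navier-Stokes equation in the same function space
and with the same initial conditions»**, read with §1.2 l.136–138 (the Leray–Hopf class «guarantee[s]
existence of weak solutions whose initial conditions have been specified») and l.1196–1197 («The LH weak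
solution defined by this data … We prove blowup for this weak solution»): for every `ν > 0` and every
admissible datum there is a global Leray–Hopf weak solution from it which is entropy maximizing in the
sense `N`. Its Leray–Hopf half is classical (Leray 1934 / Hopf 1951 on 𝕋³); its selection half depends on
the undefined `N.IsEntropyMax` (printed proof l.994–1006: «The cutoff problem is finite dimensional and the
existence of an entropy production maximizing solutions for the cutoff ν_t and u is classical»). Consumed
by the Clay link only. (GlimmPetrillo2026: Thm 3.1(a) l.975–981, §1.2 l.136–138, l.1196–1197) [claim: GlimmPetrillo2026, status: disputed] -/
def Step_2 (N : Notions) : Prop :=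
  ∀ ν : ℝ, 0 < ν →
    ∀ u₀ : UnitAddTorus (Fin 3) → EuclideanSpace ℝ (Fin 3), IsAdmissibleDatum u₀ →
      ∃ u : ℝ → UnitAddTorus (Fin 3) → EuclideanSpace ℝ (Fin 3),
        FluidPDE.Torus.IsGlobalLerayHopf ν 0 u₀ u ∧ N.IsEntropyMax ν u₀ u

/-- **Step 3 — FLOOR: the rate rule, §1.5 l.248–252: «The Navier-Stokes solutions u ∈ 𝒲^p decay with the
rate O(e^{−νt/p}) or faster. When speaking of decay rates, it is as a minimum, or lower bound to the
actual decay, with an important exception: the SRI O(e^{−νt/2}) decay rate is exact. It is not an upper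
bound.»; Fact 1 l.263–268 («u has an exact slow rate dissipation (not an upper bound dissipation rate)
O(e^{−νt/2}) as an element of 𝒲². Proof: See Lemma 3.1»); consumed in the proof of Thm 5.1 at l.1232
(«The viscous decay rate for u is O(e^{−νt/2})») and l.1239–1240 («the smooth solution viscous decay
allowed minimum value for u»); Fig. 1 l.305–308 («a forbidden region, with a bound independent of time
t > 0 … The forbidden solution decay region»).** Typed as the LOWER BOUND that l.1235–1242 consumes: for
every `ν > 0` and every non-zero admissible datum `u₀` there is `c = c(ν,u₀) > 0` such that on every
interval of regularity `[0,T)` — every classical solution `(v,p)` on `Ico 0 T` with `v 0 = u₀` — the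
norm of the solution stays above the viscous decay curve: `c·e^{−νs/2} ≤ ‖v(s)‖_{L²}` for all
`s ∈ [0,T)`. (The matching upper bound «or faster» is not consumed and not typed.) Typist's flag:
suspicious — exact Stokes-eigenmode solutions on ℝ³/ℤ³ decay like `e^{−4π²|k|²νt}`.
(GlimmPetrillo2026: §1.5 l.248–252, l.263–268; Thm 5.1 proof l.1232–1240; Fig. 1 l.305–308) [claim: GlimmPetrillo2026, status: disputed] -/
def Step_3 : Prop :=
  ∀ ν : ℝ, 0 < ν →
    ∀ u₀ : UnitAddTorus (Fin 3) → EuclideanSpace ℝ (Fin 3), IsAdmissibleDatum u₀ → u₀ ≠ 0 →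
      ∃ c : ℝ, 0 < c ∧
        ∀ (T : ℝ) (v : ℝ → UnitAddTorus (Fin 3) → EuclideanSpace ℝ (Fin 3))
          (p : ℝ → UnitAddTorus (Fin 3) → ℝ),
          FunctionSpaces.Torus.IsClassicalNSSolutionOn (Ico 0 T) ν 0 v p → v 0 = u₀ →
            ∀ s ∈ Ico 0 T, c * Real.exp (-(ν / 2) * s) ≤ solNorm v s

/-- **Step 4 — CEILING: Theorem 3.1 (b), l.983–984: «The entropy principle u and ν_t^int are elements of
𝒲, with decay O(e^{−4νt/3})»; Fact 2 l.270–277; consumed in the proof of Thm 5.1 at l.1228–1229: «ν_t(s)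
∈ 𝒲 decreases as a function of s at least at the rate O(e^{−4νt/3})».** Typed for `ν_t` (the consumed
quantity): for every `ν > 0` and every admissible datum `u₀` there is `C = C(ν,u₀)` such that on every
interval of regularity `[0,T)` (classical `(v,p)` on `Ico 0 T`, `v 0 = u₀`),
`ν_t(s) ≤ C·e^{−4νs/3}` for all `s ∈ [0,T)`. Printed proof l.1008–1015: «Since L^{4/3}(0,T;𝒱*L¹(0,T;𝒱))
was already identified as a limit point, the entropy principle selection for u … must dissipate turbulent
fluctuations at least according to L^{4/3}(…)» — an instance of the rate rule `RateRuleD1` with `p = 4/3`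
(note `e^{−νt/p} = e^{−3νt/4}`, the value printed in §1.5 l.274; Thm 3.1(b)/Thm 5.1 print `4/3`, typed
here). Typist's flag: plausible on ℝ³/ℤ³ along global solutions, unverifiable on a blow-up interval.
(GlimmPetrillo2026: Thm 3.1(b) l.983–984, l.1008–1015; Thm 5.1 proof l.1228–1229) [claim: GlimmPetrillo2026, status: disputed] -/
def Step_4 : Prop :=
  ∀ ν : ℝ, 0 < ν →
    ∀ u₀ : UnitAddTorus (Fin 3) → EuclideanSpace ℝ (Fin 3), IsAdmissibleDatum u₀ →
      ∃ C : ℝ,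
        ∀ (T : ℝ) (v : ℝ → UnitAddTorus (Fin 3) → EuclideanSpace ℝ (Fin 3))
          (p : ℝ → UnitAddTorus (Fin 3) → ℝ),
          FunctionSpaces.Torus.IsClassicalNSSolutionOn (Ico 0 T) ν 0 v p → v 0 = u₀ →
            ∀ s ∈ Ico 0 T, nuT (Ico 0 T) v s ≤ C * Real.exp (-(4 * ν / 3) * s)

/-- **Step 5 — DOMINATION: Theorem 3.1 (c), l.986–991: «The entropy principle ν_t^int is non-negative and
at least equal to the decay of the solution u. The norm of entropy principle u in 𝒲 and its norm in 𝒲 is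
smaller than the norm of ν_t^int in 𝒲»; Fact 3 l.279–285; §2.8 l.717–721 («the orange ν_t dissipation
curve must always be above the yellow viscous decay curve»); consumed in the proof of Thm 5.1 at l.1230:
«[ν_t(s)] is always greater than the solution u decay curve».** Typed for `ν_t` and the `L²` norm of the
solution: on every interval of regularity `[0,T)` of every admissible datum, for all `s ∈ [0,T)`,
`0 ≤ ν_t(s)` and `‖v(s)‖_{L²} ≤ ν_t(s)`. Printed proof l.1017–1024 = `Thm31cProofInference`. Typist's
flag: suspicious (`ν_t` is quadratic in the amplitude of the solution, the norm linear).
(GlimmPetrillo2026: Thm 3.1(c) l.986–991, l.1017–1024; Thm 5.1 proof l.1230; §2.8 l.717–721) [claim: GlimmPetrillo2026, status: disputed] -/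
def Step_5 : Prop :=
  ∀ ν : ℝ, 0 < ν →
    ∀ u₀ : UnitAddTorus (Fin 3) → EuclideanSpace ℝ (Fin 3), IsAdmissibleDatum u₀ →
      ∀ (T : ℝ) (v : ℝ → UnitAddTorus (Fin 3) → EuclideanSpace ℝ (Fin 3))
        (p : ℝ → UnitAddTorus (Fin 3) → ℝ),
        FunctionSpaces.Torus.IsClassicalNSSolutionOn (Ico 0 T) ν 0 v p → v 0 = u₀ →
          ∀ s ∈ Ico 0 T, 0 ≤ nuT (Ico 0 T) v s ∧ solNorm v s ≤ nuT (Ico 0 T) v s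

/-- **Step 3, reading R2 (same locators as `Step_3`: §1.5 l.248–252, l.263–268; Thm 5.1 proof l.1232
«The viscous decay rate for u is O(e^{−νt/2})», l.1239–1240; Fig. 1 l.305–308 «the solution viscous
decay … The forbidden solution decay region»)** with «the decay of u» read as the VISCOUS DISSIPATION RATE
`ν‖∇v(s)‖²` (`dissRate`): on every interval of regularity of a non-zero admissible datum,
`c·e^{−νs/2} ≤ ν‖∇v(s)‖²` with `c = c(ν,u₀) > 0`. Typist's flag: suspicious (eigenmodes).
(GlimmPetrillo2026: §1.5 l.248–252; Thm 5.1 proof l.1232–1240; Fig. 1 l.305–308) [claim: GlimmPetrillo2026, status: disputed] -/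
def Step_3alt : Prop :=
  ∀ ν : ℝ, 0 < ν →
    ∀ u₀ : UnitAddTorus (Fin 3) → EuclideanSpace ℝ (Fin 3), IsAdmissibleDatum u₀ → u₀ ≠ 0 →
      ∃ c : ℝ, 0 < c ∧
        ∀ (T : ℝ) (v : ℝ → UnitAddTorus (Fin 3) → EuclideanSpace ℝ (Fin 3))
          (p : ℝ → UnitAddTorus (Fin 3) → ℝ),
          FunctionSpaces.Torus.IsClassicalNSSolutionOn (Ico 0 T) ν 0 v p → v 0 = u₀ →
            ∀ s ∈ Ico 0 T, c * Real.exp (-(ν / 2) * s) ≤ dissRate ν v s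

/-- **Step 5, reading R2 (same locators as `Step_5`: Thm 3.1(c) l.986–991; §2.8 l.717–721 «This
non-viscous dissipation is a positive addition to its viscous dissipation … the orange ν_t dissipation
curve must always be above the yellow viscous decay curve»; Thm 5.1 proof l.1230)** with «the decay of
the solution u» read as the viscous dissipation rate: on every interval of regularity of an admissible
datum, `0 ≤ ν_t(s)` and `ν‖∇v(s)‖² ≤ ν_t(s)`. Typist's flag: for a classical solution the energy identity
gives `ν_t(s) = ν‖∇v(s)‖²` (so R2 makes this step plausible and isolates the floor `Step_3alt`).
(GlimmPetrillo2026: Thm 3.1(c) l.986–991; §2.8 l.717–721; Thm 5.1 proof l.1230) [claim: GlimmPetrillo2026, status: disputed] -/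
def Step_5alt : Prop :=
  ∀ ν : ℝ, 0 < ν →
    ∀ u₀ : UnitAddTorus (Fin 3) → EuclideanSpace ℝ (Fin 3), IsAdmissibleDatum u₀ →
      ∀ (T : ℝ) (v : ℝ → UnitAddTorus (Fin 3) → EuclideanSpace ℝ (Fin 3))
        (p : ℝ → UnitAddTorus (Fin 3) → ℝ),
        FunctionSpaces.Torus.IsClassicalNSSolutionOn (Ico 0 T) ν 0 v p → v 0 = u₀ →
          ∀ s ∈ Ico 0 T, 0 ≤ nuT (Ico 0 T) v s ∧ dissRate ν v s ≤ nuT (Ico 0 T) v s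

/-- **Step 6 — PRIZE LINK, §1.4 l.209–217 (the paper's reading of Fefferman's periodic problem): «Then
there exist smooth functions p(x,t), u_i(x,t) on ℝ³ × [0,∞) that satisfy conditions including 1. the
Navier-Stokes equation; 2. divergence free; 3. initial conditions given by u⁰(x); 10. periodicity; 11.
smoothness. … If it can be shown that these conditions are not satisfied for some weak solution of the
Navier-Stokes equation, the prize problem is solved in the negative. We solve the prize problem in the
negative. We choose f = 0.»** Typed in the form the negative direction needs, for Leray–Hopf weak
solutions (§1.2) and the errata reading of «10. periodicity» (u AND p periodic): for `ν > 0` and a smooth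
divergence-free datum `u₀` on `ℝ³/ℤ³`, if some global Leray–Hopf weak solution from `u₀` is not globally
regular, then the Cauchy problem for the periodic lift of `u₀` with `f ≡ 0` has no Clay-sense solution
with `u`, `p` periodic (`ClayVariants.clayPeriodicErrata.Solvable`). Classical: contrapositive of
weak–strong uniqueness on 𝕋³ (Robinson–Rodrigo–Sadowski Thm 6.10; tree
`Literature.Analysis.FluidPDE.Torus.IsLerayHopfOn.ae_eq_of_isClassicalNSSolutionOn`, p461824) after
descending the Clay solution to the torus (`IsClassicalNSSolutionOn.to_torus_holds`). The printed-(D)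
form (pressure unconstrained) needs in addition a Galilean/pressure normalisation and is not typed.
Consumed by the Clay link only. (GlimmPetrillo2026: §1.4 l.187–227) [claim: GlimmPetrillo2026, status: disputed] [cite: RobinsonRodrigoSadowski2016, Thm. 6.10] -/
def Step_6 : Prop :=
  ∀ ν : ℝ, 0 < ν →
    ∀ u₀ : UnitAddTorus (Fin 3) → EuclideanSpace ℝ (Fin 3),
      FunctionSpaces.Torus.IsSmooth u₀ → FunctionSpaces.Torus.IsDivFree u₀ →
      ∀ u : ℝ → UnitAddTorus (Fin 3) → EuclideanSpace ℝ (Fin 3),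
        FluidPDE.Torus.IsGlobalLerayHopf ν 0 u₀ u → ¬ IsGloballyRegular ν u₀ u →
          ¬ ClayVariants.clayPeriodicErrata.Solvable ν 0 (FunctionSpaces.Torus.lift u₀)

/-! ## Support declarations (printed, typed, NOT consumed by any composition) -/

/-- **Lemma 3.1, l.935–936: «The energy is conserved under weak limits, up to viscous losses»** (proof
l.938–959: the pairing of eq. (weak-en) with `u`, eq. (weak-en-1)/(cons-en)), for the weak solutions of
the paper (Leray–Hopf, zero force): the ENERGY EQUALITY `½‖u(t)‖² + ν∫₀ᵗ‖∇u‖² = ½‖u₀‖²` for every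
`t ≥ 0` and every global Leray–Hopf solution on 𝕋³. Cited at l.268 as the proof of Fact 1 (the floor
`Step_3`), which it does not imply; for Leray–Hopf solutions in 3D only the inequality is known.
(GlimmPetrillo2026: Lemma 3.1 l.935–959) [claim: GlimmPetrillo2026, status: disputed] -/
def Lemma31 : Prop :=
  ∀ ν : ℝ, 0 < ν →
    ∀ (u₀ : UnitAddTorus (Fin 3) → EuclideanSpace ℝ (Fin 3))
      (u : ℝ → UnitAddTorus (Fin 3) → EuclideanSpace ℝ (Fin 3)),
      FluidPDE.Torus.IsGlobalLerayHopf ν 0 u₀ u →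
        ∀ t : ℝ, 0 ≤ t →
          FunctionSpaces.Torus.kineticEnergy (u t) +
              ν * (∫⁻ τ in Ioo 0 t, FunctionSpaces.Torus.eGradNormSq (u τ)).toReal =
            FunctionSpaces.Torus.kineticEnergy u₀

/-- **Theorem 4.1, l.1163–1169: «Let u be a weak solution of the Navier-Stokes equation with initial data
orthogonal with zero spatial average. For example, let u be a LH solution with zero spatial average. u is
a strong solution except for possible isolated singular times t_j ≠ 0.»** (also l.1079–1081). Typed: for
every global Leray–Hopf solution from an admissible datum there is a set `Σ ⊆ (0,∞)` of singular times,
with no accumulation point in `[0,∞)` (isolated, `0 ∉ Σ` with a first regular interval), off which `u` is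
regular: on every `[a,b] ⊆ [0,∞) ∖ Σ` it coincides a.e. slice-wise with a classical solution (from `u₀`
when `a = 0`: «the initial conditions are achieved continuously», l.1172–1173). Not consumed
by the proof of Thm 5.1 beyond l.1210–1211. (GlimmPetrillo2026: Thm 4.1 l.1163–1175, l.1079–1081) [claim: GlimmPetrillo2026, status: disputed] -/
def Theorem41 : Prop :=
  ∀ ν : ℝ, 0 < ν →
    ∀ (u₀ : UnitAddTorus (Fin 3) → EuclideanSpace ℝ (Fin 3))
      (u : ℝ → UnitAddTorus (Fin 3) → EuclideanSpace ℝ (Fin 3)),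
      IsAdmissibleDatum u₀ → FluidPDE.Torus.IsGlobalLerayHopf ν 0 u₀ u →
        ∃ Sing : Set ℝ, Sing ⊆ Ioi 0 ∧
          (∀ R : ℝ, (Sing ∩ Icc 0 R).Finite) ∧
          ∀ a b : ℝ, 0 ≤ a → a < b → Disjoint (Icc a b) Sing →
            ∃ (v : ℝ → UnitAddTorus (Fin 3) → EuclideanSpace ℝ (Fin 3))
              (p : ℝ → UnitAddTorus (Fin 3) → ℝ),
              FunctionSpaces.Torus.IsClassicalNSSolutionOn (Icc a b) ν 0 v p ∧ (a = 0 → v 0 = u₀) ∧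
                ∀ t ∈ Ioc a b, u t =ᵐ[volume] v t

/-- **The rate rule of §1.5 in its abstract form (F15), l.248–249: «The Navier-Stokes solutions
u ∈ 𝒲^p decay with the rate O(e^{−νt/p}) or faster»** — membership of a time-dependent quantity in
`L^p(0,∞)` (with weight `ν`) is converted into pointwise exponential decay at rate `ν/p`; this is the
printed justification of both the ceiling (`p = 4/3`, l.1008–1015) and the floor's rate (`p = 2`).
Typed over real functions: every `g` with `∫₀^∞ |g|^p < ∞` is `O(e^{−νt/p})`. (GlimmPetrillo2026: §1.5 l.248–252 and Thm 3.1(b) proof l.1008–1015) [claim: GlimmPetrillo2026, status: disputed] -/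
def RateRuleD1 : Prop :=
  ∀ ν : ℝ, 0 < ν → ∀ p : ℝ, 0 < p →
    ∀ g : ℝ → ℝ, IntegrableOn (fun t => |g t| ^ p) (Ioi 0) →
      ∃ C : ℝ, ∀ t : ℝ, 0 ≤ t → |g t| ≤ C * Real.exp (-(ν / p) * t)

/-- **The inference printed as the proof of Theorem 3.1 (c), l.1020–1023 (F15): «The entropy principle u
is the sum of the non-negative ν_t^int and a positive viscous decay. Thus the entropy principle u is
strictly smaller than ν_t^int if ν_t^int is not zero.»** As an inference between real quantities:
`x = y + z`, `y ≥ 0`, `y ≠ 0`, `z > 0` ⟹ `x < y`. (GlimmPetrillo2026: Thm 3.1(c) proof l.1017–1024) [claim: GlimmPetrillo2026, status: disputed] -/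
def Thm31cProofInference : Prop :=
  ∀ x y z : ℝ, 0 ≤ y → y ≠ 0 → 0 < z → x = y + z → x < y

/-- **Theorem 7.1, l.1445–1451 (the «mean», OTHER direction): «The mean is smooth for all positive
times. The mean [attains] its initial conditions (eq:ic) in ℋ. The mean of a weak solution u of the
Navier-Stokes equation in ℋ is a solution of the Navier-Stokes equation in ℋ.»** The mean `𝓜` is defined
in print only as a normalised sum of three undefined averages (Theorem 6.1.1 l.1339–1351, «The mean has
entropy zero»); it is carried here as an arbitrary operator `mean` on weak solutions (F17). Typed: for
every global Leray–Hopf solution `u` from an admissible datum, `mean u` is (with some pressure) a global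
classical Navier–Stokes solution on 𝕋³ with datum `mean u 0` — the proof l.1473–1500 asserts it solves
the HEAT equation (eq. (ns-mean) l.1476) and the Navier–Stokes equation at once. v10 l.222–226: «The mean
does not have general initial data. For this reason, the mean is not a positive solution of the
Millennium Fluids problem» (the withdrawn companion arXiv:2505.13816v2 Thm 3.1 had offered it as such).
Not part of the negative composition. (GlimmPetrillo2026: Thm 7.1 l.1445–1501, Thm 6.1.1 l.1339–1351, §1.4 l.222–226) [claim: GlimmPetrillo2026, status: disputed] -/
def Theorem71
    (mean : (ℝ → UnitAddTorus (Fin 3) → EuclideanSpace ℝ (Fin 3)) →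
      (ℝ → UnitAddTorus (Fin 3) → EuclideanSpace ℝ (Fin 3))) : Prop :=
  ∀ ν : ℝ, 0 < ν →
    ∀ (u₀ : UnitAddTorus (Fin 3) → EuclideanSpace ℝ (Fin 3))
      (u : ℝ → UnitAddTorus (Fin 3) → EuclideanSpace ℝ (Fin 3)),
      IsAdmissibleDatum u₀ → FluidPDE.Torus.IsGlobalLerayHopf ν 0 u₀ u →
        ∃ p : ℝ → UnitAddTorus (Fin 3) → ℝ,
          FunctionSpaces.Torus.IsClassicalNSSolutionOn (Ici 0) ν 0 (mean u) p ∧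
            ∀ t : ℝ, 0 ≤ t → ∀ x,
              FunctionSpaces.Torus.timeDerivWithin (Ici 0) (mean u) t x =
                ν • FunctionSpaces.Torus.laplacian (mean u t) x

/-! ## Kernel compositions of the paper's implications -/

/-- **The arithmetic of eq. (compare), l.291–298 / Thm 5.1 proof l.1235–1242 (VALID):** a quantity
squeezed at time `s ≥ 0` between the floor `c·e^{−νs/2}` (`c > 0`) and the ceiling `C·e^{−4νs/3}` satisfies
`s ≤ (6/(5ν))·log(C/c)` — «O(e^{−3νT/4}) ≥ O(e^{−νT/2}) is logicly contradictory for large T».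
(GlimmPetrillo2026: eq. (compare) l.291–298 and Thm 5.1 proof l.1235–1243) [claim: GlimmPetrillo2026, status: disputed] -/
theorem le_horizon_of_decay_sandwich {ν c C s : ℝ} (hν : 0 < ν) (hc : 0 < c)
    (h : c * Real.exp (-(ν / 2) * s) ≤ C * Real.exp (-(4 * ν / 3) * s)) :
    s ≤ 6 / (5 * ν) * Real.log (C / c) := by
  have hE : 0 < Real.exp (-(4 * ν / 3) * s) := Real.exp_pos _
  have hCpos : 0 < C := by
    have h1 : 0 < C * Real.exp (-(4 * ν / 3) * s) :=
      lt_of_lt_of_le (mul_pos hc (Real.exp_pos _)) h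
    exact pos_of_mul_pos_left (by simpa [mul_comm] using h1) hE.le
  -- divide: e^{(4/3 - 1/2) ν s} ≤ C / c
  have hkey : Real.exp (5 * ν / 6 * s) ≤ C / c := by
    rw [le_div_iff₀ hc]
    have h2 : c * Real.exp (-(ν / 2) * s) = (Real.exp (5 * ν / 6 * s) * c) *
        Real.exp (-(4 * ν / 3) * s) := by
      rw [mul_comm (Real.exp _) c, mul_assoc, ← Real.exp_add]
      congr 1
      ring_nf
    rw [h2] at h
    exact le_of_mul_le_mul_right h hE
  have hlog : 5 * ν / 6 * s ≤ Real.log (C / c) := by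
    rw [← Real.log_exp (5 * ν / 6 * s)]
    exact Real.log_le_log (Real.exp_pos _) hkey
  have h5 : 0 < 5 * ν / 6 := by positivity
  calc s = (5 * ν / 6 * s) / (5 * ν / 6) := by field_simp
    _ ≤ Real.log (C / c) / (5 * ν / 6) := div_le_div_of_nonneg_right hlog h5.le
    _ = 6 / (5 * ν) * Real.log (C / c) := by
        field_simp

/-- THE CONCLUSION OF THE DECAY-RATE COMPARISON (l.1241–1243 «An endpoint to the epoch of regularity has
been reached. This time is T* < ∞»), at the level at which the proof operates: every non-zero admissible
datum has a finite horizon `T* = T*(ν,u₀)` bounding every interval `[0,T)` carrying a classical solution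
from it. Both readings R1 (`Step_3`/`Step_5`) and R2 (`Step_3alt`/`Step_5alt`) of the three facts yield
it (`finiteHorizon_of_steps`, `finiteHorizon_of_steps_alt`), and it yields both typings of the headline
(`claimed_of_finiteHorizon`, `claimedClassical_of_finiteHorizon`). Bookkeeping definition, not a step.
(GlimmPetrillo2026: Thm 5.1 proof l.1235–1243) [claim: GlimmPetrillo2026, status: disputed] -/
def FiniteHorizon : Prop :=
  ∀ ν : ℝ, 0 < ν →
    ∀ u₀ : UnitAddTorus (Fin 3) → EuclideanSpace ℝ (Fin 3), IsAdmissibleDatum u₀ → u₀ ≠ 0 →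
      ∃ Tstar : ℝ, 0 ≤ Tstar ∧
        ∀ (T : ℝ) (v : ℝ → UnitAddTorus (Fin 3) → EuclideanSpace ℝ (Fin 3))
          (p : ℝ → UnitAddTorus (Fin 3) → ℝ),
          FunctionSpaces.Torus.IsClassicalNSSolutionOn (Ico 0 T) ν 0 v p → v 0 = u₀ → T ≤ Tstar

/-- The sandwich argument of l.1228–1243 for an arbitrary «decay of u» functional `size`: a floor
`c·e^{−νs/2} ≤ size`, the domination `size ≤ ν_t` and the ceiling `ν_t ≤ C·e^{−4νs/3}` along every
classical solution from `u₀` bound the horizon by `max 0 ((6/(5ν)) log(C/c))`.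
(GlimmPetrillo2026: Thm 5.1 proof l.1228–1243) [claim: GlimmPetrillo2026, status: disputed] -/
theorem horizon_le_of_sandwich {ν : ℝ} (hν : 0 < ν)
    {u₀ : UnitAddTorus (Fin 3) → EuclideanSpace ℝ (Fin 3)}
    (size : (ℝ → UnitAddTorus (Fin 3) → EuclideanSpace ℝ (Fin 3)) → ℝ → ℝ) {c C : ℝ} (hc : 0 < c)
    (hfloor : ∀ (T : ℝ) (v : ℝ → UnitAddTorus (Fin 3) → EuclideanSpace ℝ (Fin 3))
      (p : ℝ → UnitAddTorus (Fin 3) → ℝ),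
      FunctionSpaces.Torus.IsClassicalNSSolutionOn (Ico 0 T) ν 0 v p → v 0 = u₀ →
        ∀ s ∈ Ico 0 T, c * Real.exp (-(ν / 2) * s) ≤ size v s)
    (hdom : ∀ (T : ℝ) (v : ℝ → UnitAddTorus (Fin 3) → EuclideanSpace ℝ (Fin 3))
      (p : ℝ → UnitAddTorus (Fin 3) → ℝ),
      FunctionSpaces.Torus.IsClassicalNSSolutionOn (Ico 0 T) ν 0 v p → v 0 = u₀ →
        ∀ s ∈ Ico 0 T, size v s ≤ nuT (Ico 0 T) v s)
    (hceil : ∀ (T : ℝ) (v : ℝ → UnitAddTorus (Fin 3) → EuclideanSpace ℝ (Fin 3))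
      (p : ℝ → UnitAddTorus (Fin 3) → ℝ),
      FunctionSpaces.Torus.IsClassicalNSSolutionOn (Ico 0 T) ν 0 v p → v 0 = u₀ →
        ∀ s ∈ Ico 0 T, nuT (Ico 0 T) v s ≤ C * Real.exp (-(4 * ν / 3) * s)) :
    ∀ (T : ℝ) (v : ℝ → UnitAddTorus (Fin 3) → EuclideanSpace ℝ (Fin 3))
      (p : ℝ → UnitAddTorus (Fin 3) → ℝ),
      FunctionSpaces.Torus.IsClassicalNSSolutionOn (Ico 0 T) ν 0 v p → v 0 = u₀ →
        T ≤ max 0 (6 / (5 * ν) * Real.log (C / c)) := by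
  intro T v p hv h0
  by_contra hT
  rw [not_le] at hT
  -- a time `s ∈ [0,T)` beyond the horizon
  set K : ℝ := max 0 (6 / (5 * ν) * Real.log (C / c)) with hK
  have hK0 : 0 ≤ K := le_max_left _ _
  set s : ℝ := (K + T) / 2 with hs
  have hsK : K < s := by rw [hs]; linarith
  have hsT : s < T := by rw [hs]; linarith
  have hmem : s ∈ Ico 0 T := ⟨hK0.trans hsK.le, hsT⟩
  have hsle : s ≤ 6 / (5 * ν) * Real.log (C / c) :=
    le_horizon_of_decay_sandwich hν hc
      ((hfloor T v p hv h0 s hmem).trans ((hdom T v p hv h0 s hmem).trans (hceil T v p hv h0 s hmem)))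
  exact absurd (hsle.trans (le_max_right 0 _)) (not_le.mpr hsK)

/-- **Steps 3, 4, 5 (reading R1: «decay of u» = `‖u(s)‖_{L²}`) give the finite horizon** — the proof of
Thm 5.1, l.1228–1243, at the level of classical solutions. (GlimmPetrillo2026: Thm 5.1 proof l.1228–1243) [claim: GlimmPetrillo2026, status: disputed] -/
theorem finiteHorizon_of_steps (h3 : Step_3) (h4 : Step_4) (h5 : Step_5) : FiniteHorizon := by
  intro ν hν u₀ hu₀ hne
  obtain ⟨c, hc, hfloor⟩ := h3 ν hν u₀ hu₀ hne
  obtain ⟨C, hceil⟩ := h4 ν hν u₀ hu₀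
  exact ⟨_, le_max_left _ _, horizon_le_of_sandwich hν solNorm hc hfloor
    (fun T v p hv h0 s hs => (h5 ν hν u₀ hu₀ T v p hv h0 s hs).2) hceil⟩

/-- **Steps 3alt, 4, 5alt (reading R2: «decay of u» = `ν‖∇u(s)‖²`) give the same finite horizon.**
(GlimmPetrillo2026: Thm 5.1 proof l.1228–1243) [claim: GlimmPetrillo2026, status: disputed] -/
theorem finiteHorizon_of_steps_alt (h3 : Step_3alt) (h4 : Step_4) (h5 : Step_5alt) :
    FiniteHorizon := by
  intro ν hν u₀ hu₀ hne
  obtain ⟨c, hc, hfloor⟩ := h3 ν hν u₀ hu₀ hne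
  obtain ⟨C, hceil⟩ := h4 ν hν u₀ hu₀
  exact ⟨_, le_max_left _ _, horizon_le_of_sandwich hν (dissRate ν) hc hfloor
    (fun T v p hv h0 s hs => (h5 ν hν u₀ hu₀ T v p hv h0 s hs).2) hceil⟩

/-- **From the finite horizon to Theorem 5.1 at the classical level**: no global classical solution
(restrict a global one to `[0, T*+1)`, `FunctionSpaces.Torus.IsClassicalNSSolutionOn.mono`). The
hypothesis `N.IsTurbulent` is not used: the mechanism is blind to it. (GlimmPetrillo2026: Thm 5.1 l.1204–1243) [claim: GlimmPetrillo2026, status: disputed] -/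
theorem claimedClassical_of_finiteHorizon (N : Notions) (h : FiniteHorizon) :
    ClaimedTheoremClassical N := by
  intro ν hν u₀ hfm hne _
  obtain ⟨Tstar, hT0, hhor⟩ := h ν hν u₀ hfm.isAdmissibleDatum hne
  refine ⟨⟨Tstar, hhor⟩, ?_⟩
  rintro ⟨v, p, hv, h0⟩
  have hv' : FunctionSpaces.Torus.IsClassicalNSSolutionOn (Ico 0 (Tstar + 1)) ν 0 v p :=
    hv.mono Ico_subset_Ici_self (uniqueDiffOn_Ico 0 (Tstar + 1))
  have := hhor (Tstar + 1) v p hv' h0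
  linarith

/-- **From the finite horizon to Theorem 5.1 as printed (Leray–Hopf level)**: an interval of regularity
`[0,T)` of the selected solution carries a classical solution from `u₀` on `Ico 0 T`; a global classical
representative would give intervals of every length. Neither `N.IsTurbulent` nor `N.IsEntropyMax` nor
the Leray–Hopf property is used. (GlimmPetrillo2026: Thm 5.1 l.1204–1243) [claim: GlimmPetrillo2026, status: disputed] -/
theorem claimed_of_finiteHorizon (N : Notions) (h : FiniteHorizon) : ClaimedTheorem N := by
  intro ν hν u₀ hfm hne _ u _ _
  obtain ⟨Tstar, hT0, hhor⟩ := h ν hν u₀ hfm.isAdmissibleDatum hne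
  refine ⟨⟨Tstar, fun T hT => ?_⟩, ?_⟩
  · obtain ⟨v, p, hv, h0, -⟩ := hT
    exact hhor T v p hv h0
  · rintro ⟨v, p, hv, h0, -⟩
    have hv' : FunctionSpaces.Torus.IsClassicalNSSolutionOn (Ico 0 (Tstar + 1)) ν 0 v p :=
      hv.mono Ico_subset_Ici_self (uniqueDiffOn_Ico 0 (Tstar + 1))
    have := hhor (Tstar + 1) v p hv' h0
    linarith

/-- **THE COMPOSITION, classical level** (refuter-3's reading of Thm 5.1) from Steps 3, 4, 5.
(GlimmPetrillo2026: Thm 5.1 l.1204–1243) [claim: GlimmPetrillo2026, status: disputed] -/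
theorem claimClassical_of_steps (N : Notions) (h3 : Step_3) (h4 : Step_4) (h5 : Step_5) :
    ClaimedTheoremClassical N :=
  claimedClassical_of_finiteHorizon N (finiteHorizon_of_steps h3 h4 h5)

/-- **THE COMPOSITION (README Lean convention 4; hypotheses in step order).** Theorem 5.1 as printed
follows in the kernel from the typed steps, for EVERY reading `N` of the two undefined qualifiers; the
proof CONSUMES `Step_3` (floor), `Step_4` (ceiling), `Step_5` (domination) only — exactly as the printed
proof l.1228–1243 does — through `le_horizon_of_decay_sandwich`. `Step_1`, `Step_2` (existence) and
`Step_6` (prize link) are taken in order and not used here (they are consumed by `clay_of_claimed`).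
(GlimmPetrillo2026: Thm 5.1 l.1204–1243) [claim: GlimmPetrillo2026, status: disputed] -/
theorem claim_of_steps (N : Notions) :
    Step_1 N → Step_2 N → Step_3 → Step_4 → Step_5 → Step_6 → ClaimedTheorem N :=
  fun _ _ h3 h4 h5 _ => claimed_of_finiteHorizon N (finiteHorizon_of_steps h3 h4 h5)

/-- **The composition under reading R2** (`Step_3alt`, `Step_5alt` in place of `Step_3`, `Step_5`).
(GlimmPetrillo2026: Thm 5.1 l.1204–1243) [claim: GlimmPetrillo2026, status: disputed] -/
theorem claim_of_steps_alt (N : Notions) :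
    Step_1 N → Step_2 N → Step_3alt → Step_4 → Step_5alt → Step_6 → ClaimedTheorem N :=
  fun _ _ h3 h4 h5 _ => claimed_of_finiteHorizon N (finiteHorizon_of_steps_alt h3 h4 h5)

/-- **The Clay link from the finite horizon, the existence steps and the prize sentence**: for every
`ν > 0`, a turbulent non-zero finite-mode datum exists (`Step_1`), its entropy-maximizing global
Leray–Hopf solution exists (`Step_2`), by the headline it is not globally regular, so by `Step_6` the
periodic lift of the datum — a `C^∞`, divergence-free, `ℤ³`-periodic field on `ℝ³` — admits no Clay-sense
solution with `u`, `p` periodic and `f ≡ 0`, which is `clayPeriodicErrata.BreakdownAt ν` with the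
admissible witness force `0` (`ClaySpec.BreakdownAt.of_not_solvable`).
(GlimmPetrillo2026: §1.4 l.209–220 and Thm 5.1 l.1204–1207) [claim: GlimmPetrillo2026, status: disputed] -/
theorem clay_of_finiteHorizon (N : Notions) (h1 : Step_1 N) (h2 : Step_2 N) (h : FiniteHorizon)
    (h6 : Step_6) : ClayVariants.clayPeriodicErrata.Breakdown := by
  intro ν hν
  obtain ⟨u₀, hfm, hne, hturb⟩ := h1
  have hadm : IsAdmissibleDatum u₀ := hfm.isAdmissibleDatum
  obtain ⟨u, hLH, hsel⟩ := h2 ν hν u₀ hadm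
  have hng : ¬ IsGloballyRegular ν u₀ u :=
    (claimed_of_finiteHorizon N h ν hν u₀ hfm hne hturb u hLH hsel).2
  have hns : ¬ ClayVariants.clayPeriodicErrata.Solvable ν 0 (FunctionSpaces.Torus.lift u₀) :=
    h6 ν hν u₀ hadm.1 hadm.2.1 u hLH hng
  have hsm : ContDiff ℝ ∞ (FunctionSpaces.Torus.lift u₀) := hadm.1
  have hdiv : FluidPDE.NSWave0.IsDivFree (FunctionSpaces.Torus.lift u₀) :=
    (FluidPDE.isDivFree_lift_iff (hadm.1.isContDiff (by simp))).2 hadm.2.1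
  have hper : FluidPDE.IsLatticePeriodic (FunctionSpaces.Torus.lift u₀) :=
    FunctionSpaces.Torus.isLatticePeriodic_lift u₀
  exact ClayVariants.ClaySpec.BreakdownAt.of_not_solvable (S := ClayVariants.clayPeriodicErrata)
    hsm hdiv hper ClayVariants.isSmoothOnHalfSpace_zero ClayVariants.clayPeriodicErrata_force_zero hns

/-- **The Clay link (TYPING-HYGIENE 10 (a)): the claimed theorem, with the paper's existence steps and
its §1.4 prize sentence, decides the errata form of Clay (D)** — all six steps consumed. Escalation-grade
if Steps 1–6 resisted; they are typed, not asserted. (GlimmPetrillo2026: §1.4 l.209–220 and Thm 5.1 l.1204–1207) [claim: GlimmPetrillo2026, status: disputed] -/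
theorem clay_of_claimed (N : Notions) :
    Step_1 N → Step_2 N → Step_3 → Step_4 → Step_5 → Step_6 →
      ClayVariants.clayPeriodicErrata.Breakdown :=
  fun h1 h2 h3 h4 h5 h6 => clay_of_finiteHorizon N h1 h2 (finiteHorizon_of_steps h3 h4 h5) h6

/-- The Clay link under reading R2. (GlimmPetrillo2026: §1.4 l.209–220 and Thm 5.1 l.1204–1207) [claim: GlimmPetrillo2026, status: disputed] -/
theorem clay_of_claimed_alt (N : Notions) :
    Step_1 N → Step_2 N → Step_3alt → Step_4 → Step_5alt → Step_6 →
      ClayVariants.clayPeriodicErrata.Breakdown :=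
  fun h1 h2 h3 h4 h5 h6 => clay_of_finiteHorizon N h1 h2 (finiteHorizon_of_steps_alt h3 h4 h5) h6

/-! ## Rev (typist-5 g5, D-0026 debt pass) — the classical steps hold in the tree (nothing above changed)

Literature-side twins of the salvage lane's kernel facts
(`Summit.NavierStokesRegularity.NavierStokesRegularity.Theorems.GlimmPetrillo2026.step_2_natural`,
`nuT_eq_dissRate`, `step_5alt_holds`, `step_6_holds` in `Theorems/SoloSalvageGlimmPetrillo2026.lean`,
ns-claims-salvage-p2 — not importable into `Literature/`), recorded here so that the named Props are
discharged where they are declared, plus the one-line `step_1_natural`. The locator of record (#25,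
false lemma @ `Step_3` FLOOR §1.5 l.248–252 by `…Theorems.GlimmPetrillo2026.not_Step_3`) and every
statement above are untouched. -/

/-- **Step 1 holds in the natural reading** (`Notions.natural`: «turbulent» := non-zero, Def. 5.1
l.1182–1188): a non-zero divergence-free zero-mean finite-Stokes-mode datum exists — the ABC flow
(`exists_finiteModeDatum_ne_zero`). (GlimmPetrillo2026: Def. 5.1 l.1182–1188 and Thm 5.1 proof l.1213–1216) [claim: GlimmPetrillo2026, status: disputed] -/
theorem step_1_natural : Step_1 Notions.natural := by
  obtain ⟨u₀, h, hne⟩ := exists_finiteModeDatum_ne_zero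
  exact ⟨u₀, h, hne, hne⟩

/-- **Step 2 holds in the natural (selection-free) reading: Hopf's existence theorem on `𝕋³`** (Hopf
1951; Robinson–Rodrigo–Sadowski 2016 Thm 4.4; tree `FluidPDE.hopf_existence_torus_holds`, PROVED):
every smooth divergence-free zero-mean datum launches a global Leray–Hopf weak solution of the unforced
equations. Literature-side twin of `Summit.….Theorems.GlimmPetrillo2026.step_2_natural`.
(GlimmPetrillo2026: Thm 3.1(a) l.975–981 with §1.2 l.136–138) [claim: GlimmPetrillo2026, status: disputed] [cite: RobinsonRodrigoSadowski2016, Thm. 4.4] -/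
theorem step_2_natural : Step_2 Notions.natural := by
  intro ν hν u₀ hu₀
  obtain ⟨hsm, hdiv, -⟩ := hu₀
  have hf : AEStronglyMeasurable
      (FunctionSpaces.Torus.stLift (0 : ℝ → UnitAddTorus (Fin 3) → EuclideanSpace ℝ (Fin 3)))
      (volume.restrict (Ioi 0 ×ˢ univ)) :=
    aestronglyMeasurable_const (b := (0 : EuclideanSpace ℝ (Fin 3)))
  have hf₂ : ∀ T : ℝ, 0 < T → ∫⁻ t in Ioo 0 T, ∫⁻ x : UnitAddTorus (Fin 3),
      ‖(0 : ℝ → UnitAddTorus (Fin 3) → EuclideanSpace ℝ (Fin 3)) t x‖ₑ ^ 2 < ⊤ := by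
    intro T hT; simp
  obtain ⟨u, hu⟩ := FluidPDE.hopf_existence_torus_holds ν hν u₀ (hsm.memLp 2)
    (FunctionSpaces.Torus.IsDivFree.isWeaklyDivFree_holds hsm hdiv) 0 hf hf₂
  exact ⟨u, hu, trivial⟩

/-- **The turbulent dissipation of a classical solution IS the viscous dissipation rate**: for a
classical solution `(v, p)` of the unforced equations on `𝕋³ × S` and `s ∈ S`,
`ν_t(s) = ν_{t,NL}(s) + ν_{t,Temp}(s) = 0 + ν‖∇v(s)‖²` — the paired energy identity of Lemma 3.1 at a
regular time (`∫⟪(v·∇)v, v⟫ = 0`, `∫⟪v, −∂ₜv⟫ = −∫⟪v, νΔv − ∇p − (v·∇)v⟫ = ν‖∇v‖²`; tree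
`Torus.integral_inner_convect_self_eq_zero`, `Torus.integral_inner_gradient_eq_zero_of_isDivFree`,
`Torus.integral_inner_laplacian_self_eq_neg_gradNormSq_of_isSmooth`). Literature-side twin of
`Summit.….Theorems.GlimmPetrillo2026.nuT_eq_dissRate`. (GlimmPetrillo2026: Lemma 3.1 l.935–959 and eq. (nu-NL) l.686–694) [claim: GlimmPetrillo2026, status: disputed] -/
theorem nuT_eq_dissRate {S : Set ℝ} {ν : ℝ}
    {v : ℝ → UnitAddTorus (Fin 3) → EuclideanSpace ℝ (Fin 3)} {p : ℝ → UnitAddTorus (Fin 3) → ℝ}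
    (hv : FunctionSpaces.Torus.IsClassicalNSSolutionOn S ν 0 v p) {s : ℝ} (hs : s ∈ S) :
    nuT S v s = dissRate ν v s := by
  have hvs : FunctionSpaces.Torus.IsSmooth (v s) := hv.smooth_velocity.isSmooth_slice hs
  have hps : FunctionSpaces.Torus.IsSmooth (p s) := hv.smooth_pressure.isSmooth_slice hs
  have hdiv : FunctionSpaces.Torus.IsDivFree (v s) := hv.divFree s hs
  -- the momentum equation solved for `∂ₜv`
  have hmom : ∀ x, FunctionSpaces.Torus.timeDerivWithin S v s x =
      ν • FunctionSpaces.Torus.laplacian (v s) x - FunctionSpaces.Torus.gradient (p s) x -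
        FunctionSpaces.Torus.convect (v s) (v s) x := by
    intro x
    have h := hv.momentum s hs x
    rw [Pi.zero_apply, Pi.zero_apply, add_zero] at h
    rw [← h]; abel
  have hNL : nuNL v s = 0 := FunctionSpaces.Torus.integral_inner_convect_self_eq_zero hvs hdiv
  have hTemp : nuTemp S v s = ν * FunctionSpaces.Torus.gradNormSq (v s) := by
    unfold nuTemp
    have hpt : ∀ x, ⟪v s x, -FunctionSpaces.Torus.timeDerivWithin S v s x⟫ =
        -ν * ⟪FunctionSpaces.Torus.laplacian (v s) x, v s x⟫ +
          ⟪FunctionSpaces.Torus.gradient (p s) x, v s x⟫ +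
          ⟪FunctionSpaces.Torus.convect (v s) (v s) x, v s x⟫ := by
      intro x
      rw [hmom x, inner_neg_right, inner_sub_right, inner_sub_right, inner_smul_right,
        real_inner_comm (v s x) (FunctionSpaces.Torus.laplacian (v s) x),
        real_inner_comm (v s x) (FunctionSpaces.Torus.gradient (p s) x),
        real_inner_comm (v s x) (FunctionSpaces.Torus.convect (v s) (v s) x)]
      ring
    simp_rw [hpt]
    have hi1 : Integrable (fun x => -ν * ⟪FunctionSpaces.Torus.laplacian (v s) x, v s x⟫) volume :=
      ((hvs.laplacian.inner hvs).integrable).const_mul _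
    have hi2 : Integrable (fun x => ⟪FunctionSpaces.Torus.gradient (p s) x, v s x⟫) volume :=
      (hps.gradient.inner hvs).integrable
    have hi3 : Integrable (fun x => ⟪FunctionSpaces.Torus.convect (v s) (v s) x, v s x⟫) volume :=
      ((hvs.convect hvs).inner hvs).integrable
    have hA : ∫ x, (-ν * ⟪FunctionSpaces.Torus.laplacian (v s) x, v s x⟫ +
        ⟪FunctionSpaces.Torus.gradient (p s) x, v s x⟫ +
        ⟪FunctionSpaces.Torus.convect (v s) (v s) x, v s x⟫) =
        (∫ x, -ν * ⟪FunctionSpaces.Torus.laplacian (v s) x, v s x⟫) +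
          (∫ x, ⟪FunctionSpaces.Torus.gradient (p s) x, v s x⟫) +
          ∫ x, ⟪FunctionSpaces.Torus.convect (v s) (v s) x, v s x⟫ := by
      have hi12 : Integrable (fun x => -ν * ⟪FunctionSpaces.Torus.laplacian (v s) x, v s x⟫ +
          ⟪FunctionSpaces.Torus.gradient (p s) x, v s x⟫) volume := hi1.add hi2
      rw [integral_add hi12 hi3, integral_add hi1 hi2]
    rw [hA, integral_const_mul,
      FunctionSpaces.Torus.integral_inner_laplacian_self_eq_neg_gradNormSq_of_isSmooth hvs,
      FunctionSpaces.Torus.integral_inner_gradient_eq_zero_of_isDivFree hvs hps hdiv,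
      FunctionSpaces.Torus.integral_inner_convect_self_eq_zero hvs hdiv]
    ring
  unfold nuT dissRate
  rw [hNL, hTemp, zero_add]

/-- **Step 5′ (reading R2: Theorem 3.1 (c) with «decay of u» = viscous dissipation rate) is TRUE**:
on every interval of regularity, `0 ≤ ν_t(s)` and `ν‖∇v(s)‖² ≤ ν_t(s)` (indeed `=`,
`nuT_eq_dissRate`). Literature-side twin of `Summit.….Theorems.GlimmPetrillo2026.step_5alt_holds`.
(GlimmPetrillo2026: Thm 3.1(c) l.986–991 and Thm 5.1 proof l.1230) [claim: GlimmPetrillo2026, status: disputed] -/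
theorem step_5alt_holds : Step_5alt := by
  intro ν hν u₀ _ T v p hv _ s hs
  rw [nuT_eq_dissRate hv hs]
  refine ⟨?_, le_rfl⟩
  unfold dissRate FunctionSpaces.Torus.gradNormSq
  exact mul_nonneg hν.le (integral_nonneg fun x => Finset.sum_nonneg fun i _ => sq_nonneg _)

/-- **Step 6 (the §1.4 prize sentence, errata reading) is TRUE — the contrapositive of weak–strong
uniqueness on `𝕋³`** (Robinson–Rodrigo–Sadowski 2016 Thm 6.10; tree
`FluidPDE.Torus.IsGlobalLerayHopf.ae_eq_of_isClassicalNSSolutionOn_Ici`, PROVED): if the periodic Cauchy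
problem for `lift u₀`, `f ≡ 0`, has a Clay-sense solution with `u` and `p` periodic, descend it to a
global classical solution `(v, q)` on `𝕋³` with `v 0 = u₀` (`IsClassicalNSSolutionOn.to_torus_holds`);
every global Leray–Hopf weak solution from `u₀` then coincides with `v` a.e. on every slice, i.e. is
globally regular. Literature-side twin of `Summit.….Theorems.GlimmPetrillo2026.step_6_holds`.
(GlimmPetrillo2026: §1.4 l.187–227) [claim: GlimmPetrillo2026, status: disputed] [cite: RobinsonRodrigoSadowski2016, Thm. 6.10] -/
theorem step_6_holds : Step_6 := by
  intro ν hν u₀ hsm hdiv u hLH hnot hsolv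
  apply hnot
  obtain ⟨U, P, hUs, hPs, hns, hadm⟩ := hsolv
  have hcl : FluidPDE.IsClassicalNSSolutionOn (Ici 0) ν 0 U P :=
    (FluidPDE.isNavierStokesSolution_and_smooth_iff.1 ⟨hns, hUs, hPs⟩).1
  -- descend the periodic slices to the torus
  set v : ℝ → UnitAddTorus (Fin 3) → EuclideanSpace ℝ (Fin 3) :=
    fun t x => U t (FunctionSpaces.Torus.repr x) with hv
  set q : ℝ → UnitAddTorus (Fin 3) → ℝ := fun t x => P t (FunctionSpaces.Torus.repr x) with hq
  have hvU : ∀ t ∈ Ici (0 : ℝ), (fun s => FunctionSpaces.Torus.lift (v s)) t = U t := fun t ht =>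
    FunctionSpaces.Torus.lift_descend_holds (U t) (hadm t ht).1
  have hqP : ∀ t ∈ Ici (0 : ℝ), (fun s => FunctionSpaces.Torus.lift (q s)) t = P t := fun t ht =>
    FunctionSpaces.Torus.lift_descend_holds (P t) (hadm t ht).2
  have hcl' : FluidPDE.IsClassicalNSSolutionOn (Ici 0) ν
      (fun t => FunctionSpaces.Torus.lift
        ((0 : ℝ → UnitAddTorus (Fin 3) → EuclideanSpace ℝ (Fin 3)) t))
      (fun t => FunctionSpaces.Torus.lift (v t)) (fun t => FunctionSpaces.Torus.lift (q t)) := by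
    have h0 : (fun t => FunctionSpaces.Torus.lift
        ((0 : ℝ → UnitAddTorus (Fin 3) → EuclideanSpace ℝ (Fin 3)) t)) =
        (0 : ℝ → EuclideanSpace ℝ (Fin 3) → EuclideanSpace ℝ (Fin 3)) := rfl
    rw [h0]
    exact hcl.congr_slices hvU hqP
  have htor : FunctionSpaces.Torus.IsClassicalNSSolutionOn (Ici 0) ν 0 v q :=
    FluidPDE.IsClassicalNSSolutionOn.to_torus_holds hcl'
  have hv0 : v 0 = u₀ := by
    funext x
    show U 0 (FunctionSpaces.Torus.repr x) = u₀ x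
    rw [hns.initial, FunctionSpaces.Torus.lift_apply, FunctionSpaces.Torus.proj_repr]
  refine ⟨v, q, htor, hv0, ?_⟩
  have hLH' : FluidPDE.Torus.IsGlobalLerayHopf ν 0 (v 0) u := by rw [hv0]; exact hLH
  exact hLH'.ae_eq_of_isClassicalNSSolutionOn_Ici htor hν.le

end

end Literature.Claims.NS.GlimmPetrillo2026
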